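import Literature.MathematicalPhysics.QuantumManyBody.LiebSimpleEquationFacts
import HarnessLib

/-!
# CJL-II Theorem 6 (condensate fraction), corrected rendering: `η` as a RIGHT `μ`-derivative

Named fact (D-0014) `LiebSimpleEquation.CarlenJauslinLieb2021_thm6_rightDeriv`, requested by the
cite item `wi-24851` (consumer: route AtomisticToContinuum/BECAmplitudeGas, foreseen layer-2 glue
`CJLSlopeBound ⇐ ClosureDefectBound → HierarchyFixedPoint → CJLSlopeBound`), vendoring
Carlen–Jauslin–Lieb, *Analysis of a simple equation for the ground state of the Bose gas II*,
Theorem 6 with its proof in §5 ((simpleq_eta) = (1.20), (eta) = (1.21), (etaf) = (1.25),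
(eta_asym)), in the CORRECTED reading designed and recorded — docstring and body verbatim — in the
module docstring of `LiebSimpleEquationFacts.lean`, §"CJL-II Theorem 6: the corrected rendering"
(audit of 2026-08-15). The first rendering `CarlenJauslinLieb2021_thm6` (formerly a named fact of
that file; two-sided `eta` of the least-energy selection, identically `0` by `eta_eq_zero`) is
refuted in tree (`not_CarlenJauslinLieb2021_thm6`, `LiebSimpleEquationFactsRefuted.lean`, which
states it verbatim in its type) and was retired — deprecated, then deleted — from the facts file in
the verdict clean-up of 2026-08-15, whose record there (§Verdict clean-up) points at the name
vendored here.

Source check for this file (held arXiv copy of [CarlenJauslinLieb2021] = arXiv:2010.13882, read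
2026-08-15): Theorem 6 — "Assume that `(1+|x|⁴)v(x) ∈ L¹(ℝ³) ∩ L²(ℝ³)`. The non-condensed
fraction `η` defined in (eta) satisfies `η = ρ∫v𝔎_e u dx / (1 − ρ∫v𝔎_e(2u − ρu∗u) dx)`. As
`ρ → 0`, `η` goes to `0` asymptotically as `η ∼ 8√(ρa₀³)/(3√π)` where `a₀` is the scattering
length of `v`"; §1: `(−Δ + 2μ + 4e_μ)u_μ = (1 − u_μ)v + 2ρe_μ u_μ∗u_μ`, `e_μ = (ρ/2)∫(1 − u_μ)v`,
`η = ∂_μ e_μ|_{μ=0}`; §5: "Note that `e₀ = e`, and we write `u = u₀` … One can show the existence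
of a solution … one can prove that `u_μ` is differentiable with respect to `μ` … The details of
these two proofs are left to the reader", `s := ∂_μ u_μ|_{μ=0}`,
`(2 + 4η)u + (−Δ + 4e)s = −sv + 4ρe s∗u + 2ρη u∗u`, `s = 𝔎_e(2ηρu∗u − 2u − 4ηu)`,
`η = −(ρ/2)∫sv`, "Solving for `η` yields (etaf)".

Why a sibling file and not an append: the facts file is long and shared; it only points here
(module docstring: Contents, §Verdict clean-up, §"CJL-II Theorem 6: the corrected rendering").
Proved here: the two projections `.rightDeriv` and `.asymptotics` (bookkeeping only).

## References

* [CarlenJauslinLieb2021] E. A. Carlen, I. Jauslin, E. H. Lieb, *Analysis of a simple equation for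
  the ground state of the Bose gas II: monotonicity, convexity, and condensate fraction*, SIAM J.
  Math. Anal. 53 (2021) 5322–5360 = arXiv:2010.13882: Theorem 6; §1 (1.20)–(1.21); §5.
* [CarlenJauslinLieb2020] E. A. Carlen, I. Jauslin, E. H. Lieb, *Analysis of a simple equation for
  the ground state energy of the Bose gas*, Pure Appl. Anal. 2 (2020) 659–684: Theorem 2
  (`e = 2πρa₀ + o(ρ)`, used at the end of §5), §3.2 (scattering length).
-/

noncomputable section

open MeasureTheory Filter Set
open scoped ENNReal Topology

namespace Literature.MathematicalPhysics.QuantumManyBody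

namespace LiebSimpleEquation

open BoseGas (Space)

/-- **CJL-II Theorem 6 (condensate fraction); `η` as the right `μ`-derivative of the pinned energy
along a pinned branch.** "Assume that `(1 + |x|⁴)v ∈ L¹(ℝ³) ∩ L²(ℝ³)`. The non-condensed fraction
`η` defined in (eta) [`η = ∂_μ e_μ|_{μ=0}`, `e_μ` the energy of the pinned system (simpleq_eta) =
(1.20), `(−Δ + 2μ + 4e_μ)u_μ = (1 − u_μ)v + 2ρe_μ u_μ∗u_μ`, `e_μ = (ρ/2)∫(1 − u_μ)v`, at density
`ρ`; §5: "`e₀ = e`, and we write `u = u₀` to denote the solution of the simple equation"] satisfies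
`η = ρ∫v𝔎_e u / (1 − ρ∫v𝔎_e(2u − ρu∗u))` [(etaf) = (1.25)]. As `ρ → 0`, `η` goes to `0`
asymptotically as `η ∼ 8√(ρa₀³)/(3√π)` [(eta_asym)] where `a₀` is the scattering length of `v`."
Rendering (see the module docstring of `LiebSimpleEquationFacts.lean`, "Rendering decisions"; this
definition REPLACES the deprecated first rendering `CarlenJauslinLieb2021_thm6`, whose two-sided
`eta` is identically `0`):
(a) for every solution triple `(ρ, e, u)`, `ρ, e > 0`, every branch `μ ↦ (e_μ, u_μ)`, `0 ≤ μ < μ₀`,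
of solutions of the pinned system at density `ρ` (`IsPinnedSolution v ρ μ (e_μ) (u_μ)`) with
`e_0 = e`, `u_0 = u`, along which `μ ↦ u_μ` is differentiable at `0⁺` in `L²(ℝ³)` (some `s ∈ L²`
with `‖(u_μ − u)/μ − s‖₂ → 0` as `μ → 0⁺`), the pinned energy has a right derivative at `μ = 0`
and it equals (1.25): `HasDerivWithinAt e_· (etaFormula v ρ e u) (Ici 0) 0`. This is the content of
the derivation in §5 ("Differentiating (simpleq_eta) in `μ` and setting `μ = 0`":
`(2 + 4η)u + (−Δ + 4e)s = −sv + 4ρe s∗u + 2ρη u∗u`, `s = 𝔎_e(2ηρ u∗u − 2u − 4ηu)`,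
`η = −(ρ/2)∫sv`, solved for `η`; along such a branch the denominator of (1.25) cannot vanish, since
the derivation gives `η·(1 − ρ∫v𝔎_e(2u − ρu∗u)) = ρ∫v𝔎_e u` with a positive right side, `𝔎_e`
having a positive kernel (§1.2) — cf. Remark 17, where only the SIGN of the denominator is at
issue). The derivative is one-sided because the pinned system has no solution in the physical
class for `μ < 0` (`IsPinnedSolution.mu_nonneg`, `LiebSimpleEquationPinned.lean`); the existence of
the branch and its `μ`-differentiability ("in the same way as … the differentiability of `ρ` with
respect to `e`", i.e. in `L²(ℝ³)` as in Theorem 3), which §5 asserts with "the details of these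
two proofs … left to the reader", are HYPOTHESES here, not conclusions.
(b) `etaFormula v ρ e u ∼ 8√(ρa₀³)/(3√π)` as `ρ → 0`, uniformly over solution triples (`|F − X| ≤ εX`
for `0 < ρ < ρ₀(ε)`), with `a₀ = scatteringLengthOf v φ` for a scattering solution `φ` whose
existence is part of the statement (as in `CarlenJauslinLieb2020_thm2`): this is (eta_asym) as §5
proves it, for the closed formula (etaf) (`η = (4√(2e)/(3π))a₀ + o(√e)`, then `e = 2πρa₀ + o(ρ)`
from CJL-I Theorem 2). Grounds the cite item `wi-24851`.
[cite: CarlenJauslinLieb2021, Theorem 6 and §5] -/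
def CarlenJauslinLieb2021_thm6_rightDeriv : Prop :=
  ∀ (v : Space → ℝ), IsWeightedPotential v → 0 < ∫ x, v x →
    (∀ (ρ e : ℝ) (u : Space → ℝ), 0 < ρ → 0 < e → IsSolution v ρ e u →
      ∀ (eμ : ℝ → ℝ) (uμ : ℝ → Space → ℝ) (s : Space → ℝ), eμ 0 = e → uμ 0 = u →
        (∃ μ₀ : ℝ, 0 < μ₀ ∧ ∀ μ : ℝ, 0 ≤ μ → μ < μ₀ → IsPinnedSolution v ρ μ (eμ μ) (uμ μ)) →
        MemLp s 2 →
        Tendsto (fun μ : ℝ => eLpNorm (fun x => (uμ μ x - u x) / μ - s x) 2 volume)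
          (𝓝[>] 0) (𝓝 0) →
        HasDerivWithinAt eμ (etaFormula v ρ e u) (Ici 0) 0) ∧
    (∃ φ : Space → ℝ, IsScatteringSolution v φ ∧
      ∀ ε : ℝ, 0 < ε → ∃ ρ₀ : ℝ, 0 < ρ₀ ∧
        ∀ (ρ e : ℝ) (u : Space → ℝ), 0 < ρ → ρ < ρ₀ → 0 < e → IsSolution v ρ e u →
          |etaFormula v ρ e u - 8 * Real.sqrt (ρ * scatteringLengthOf v φ ^ 3) / (3 * Real.sqrt Real.pi)|
            ≤ ε * (8 * Real.sqrt (ρ * scatteringLengthOf v φ ^ 3) / (3 * Real.sqrt Real.pi)))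

/-- Projection (a) of `CarlenJauslinLieb2021_thm6_rightDeriv`: along an `L²`-right-differentiable
pinned branch through a solution triple, the pinned energy has right derivative `etaFormula` at
`μ = 0`. [cite: CarlenJauslinLieb2021, Theorem 6 (etaf) and §5] -/
theorem CarlenJauslinLieb2021_thm6_rightDeriv.rightDeriv (h : CarlenJauslinLieb2021_thm6_rightDeriv)
    {v : Space → ℝ} (hv : IsWeightedPotential v) (hv0 : 0 < ∫ x, v x)
    {ρ e : ℝ} {u : Space → ℝ} (hρ : 0 < ρ) (he : 0 < e) (hu : IsSolution v ρ e u)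
    {eμ : ℝ → ℝ} {uμ : ℝ → Space → ℝ} {s : Space → ℝ} (he0 : eμ 0 = e) (hu0 : uμ 0 = u)
    (hbranch : ∃ μ₀ : ℝ, 0 < μ₀ ∧ ∀ μ : ℝ, 0 ≤ μ → μ < μ₀ → IsPinnedSolution v ρ μ (eμ μ) (uμ μ))
    (hs : MemLp s 2)
    (hdiff : Tendsto (fun μ : ℝ => eLpNorm (fun x => (uμ μ x - u x) / μ - s x) 2 volume)
      (𝓝[>] 0) (𝓝 0)) :
    HasDerivWithinAt eμ (etaFormula v ρ e u) (Ici 0) 0 :=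
  (h v hv hv0).1 ρ e u hρ he hu eμ uμ s he0 hu0 hbranch hs hdiff

/-- Projection (b) of `CarlenJauslinLieb2021_thm6_rightDeriv`: `etaFormula ∼ 8√(ρa₀³)/(3√π)` as
`ρ → 0` over solution triples, `a₀` the scattering length of a scattering solution.
[cite: CarlenJauslinLieb2021, Theorem 6 (eta_asym) and §5] -/
theorem CarlenJauslinLieb2021_thm6_rightDeriv.asymptotics (h : CarlenJauslinLieb2021_thm6_rightDeriv)
    {v : Space → ℝ} (hv : IsWeightedPotential v) (hv0 : 0 < ∫ x, v x) :
    ∃ φ : Space → ℝ, IsScatteringSolution v φ ∧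
      ∀ ε : ℝ, 0 < ε → ∃ ρ₀ : ℝ, 0 < ρ₀ ∧
        ∀ (ρ e : ℝ) (u : Space → ℝ), 0 < ρ → ρ < ρ₀ → 0 < e → IsSolution v ρ e u →
          |etaFormula v ρ e u - 8 * Real.sqrt (ρ * scatteringLengthOf v φ ^ 3) / (3 * Real.sqrt Real.pi)|
            ≤ ε * (8 * Real.sqrt (ρ * scatteringLengthOf v φ ^ 3) / (3 * Real.sqrt Real.pi)) :=
  (h v hv hv0).2

end LiebSimpleEquation

end Literature.MathematicalPhysics.QuantumManyBody

end
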